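import Mathlib
import Summits.Ventures.HodgeRepro2.T5InertGlobalToLocal
import Summits.Ventures.HodgeRepro2.T5LocalDegreeBounds
import Summits.Ventures.HodgeRepro2.T5SplitPlaceLocalDegree
import Summits.Ventures.HodgeRepro2.T5QuadraticPlaceTrichotomy
import Summits.Ventures.HodgeRepro2.T5CompletionDegree
import Summits.Ventures.HodgeRepro2.T5CompletionFundamentalIdentity
import Summits.Ventures.HodgeRepro2.T5CompletionDegreeOne
import Summits.Ventures.HodgeRepro2.T5CompletionDegreeSum
import Summits.Ventures.HodgeRepro2.T5QuadraticPlaceCases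

/-!
# THE TWO DICTIONARIES ARE ONE: seat p4's rows 178–193 against seat p8's T5-156–163, in kernel (T5DictionaryConcordance)

Record-class file (no new mathematics): the local-degree / global-dictionary lane on Mathlib's completions of number
fields was built twice in parallel — seat p8's `T5InertGlobalToLocal` / `T5LocalDegreeBounds` /
`T5SplitPlaceLocalDegree` / `T5QuadraticPlaceTrichotomy` (23:00Z–23:58Z) and seat p4's `T5CompletionDegree` /
`T5CompletionFundamentalIdentity` / `T5CompletionDegreeOne` / `T5CompletionDegreeSum` / `T5QuadraticPlaceCases`
(23:27Z–01:13Z) — without either seat reading the other (route/T5-CONCORDANCE-p4-p8.md). This file makes the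
prose concordance checkable: each theorem below is one side's statement proved FROM the other side's theorem, so the
rows marked SAME in the memo are interderivable in kernel, and p8's existential trichotomy follows from p4's pointwise
one. Nothing here is used by either lane; both lanes stay as filed (their importers depend on them).

No axiom beyond the standard trio; nothing of the scored record changes.
§8(d): uses an L-value-free non-vanishing device: NO.
-/

namespace Summit.Ventures.HodgeRepro2.T5DictionaryConcordance

open IsDedekindDomain HeightOneSpectrum NumberField

variable {K : Type*} [Field K] [NumberField K] (v : HeightOneSpectrum (NumberField.RingOfIntegers K))
  {L : Type*} [Field L] [NumberField L] [Algebra K L] (w : HeightOneSpectrum (NumberField.RingOfIntegers L))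
  [w.asIdeal.LiesOver v.asIdeal]

/-! ### SAME rows: the same statement, each side from the other -/

/-- `[L_w : K_v] = e · f`: p8's `T5InertGlobalToLocal.finrank_adicCompletion_eq_mul` from p4's row 187. -/
theorem p8_finrank_eq_mul_of_p4 :
    Module.finrank (v.adicCompletion K) (w.adicCompletion L) =
      v.asIdeal.ramificationIdx' w.asIdeal * v.asIdeal.inertiaDeg' w.asIdeal :=
  Summit.Ventures.HodgeRepro2.T5CompletionFundamentalIdentity.finrank_eq_ramificationIdx'_mul_inertiaDeg' v w

/-- `[L_w : K_v] = e · f`: p4's row 187 from p8's `T5InertGlobalToLocal.finrank_adicCompletion_eq_mul`. -/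
theorem p4_finrank_eq_mul_of_p8 :
    Module.finrank (v.adicCompletion K) (w.adicCompletion L) =
      v.asIdeal.ramificationIdx' w.asIdeal * v.asIdeal.inertiaDeg' w.asIdeal :=
  Summit.Ventures.HodgeRepro2.T5InertGlobalToLocal.finrank_adicCompletion_eq_mul v w

/-- `[L_w : K_v] ≤ [L : K]`: p8's `T5LocalDegreeBounds.finrank_adicCompletion_le_finrank` from p4's row 178. -/
theorem p8_finrank_le_of_p4 :
    Module.finrank (v.adicCompletion K) (w.adicCompletion L) ≤ Module.finrank K L :=
  Summit.Ventures.HodgeRepro2.T5CompletionDegree.finrank_le v w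

/-- `[L_w : K_v] ≤ [L : K]`: p4's row 178 from p8's `T5LocalDegreeBounds.finrank_adicCompletion_le_finrank`. -/
theorem p4_finrank_le_of_p8 :
    Module.finrank (v.adicCompletion K) (w.adicCompletion L) ≤ Module.finrank K L :=
  Summit.Ventures.HodgeRepro2.T5LocalDegreeBounds.finrank_adicCompletion_le_finrank v w

/-- `[L_w : K_v] = 1 ↔ e = f = 1`: p8's `T5LocalDegreeBounds.finrank_adicCompletion_eq_one_iff` from p4's row 190. -/
theorem p8_finrank_eq_one_iff_of_p4 :
    Module.finrank (v.adicCompletion K) (w.adicCompletion L) = 1 ↔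
      v.asIdeal.ramificationIdx' w.asIdeal = 1 ∧ v.asIdeal.inertiaDeg' w.asIdeal = 1 :=
  Summit.Ventures.HodgeRepro2.T5CompletionDegreeOne.finrank_eq_one_iff v w

/-- `[L_w : K_v] = 1 ↔ e = f = 1`: p4's row 190 from p8's `T5LocalDegreeBounds.finrank_adicCompletion_eq_one_iff`. -/
theorem p4_finrank_eq_one_iff_of_p8 :
    Module.finrank (v.adicCompletion K) (w.adicCompletion L) = 1 ↔
      v.asIdeal.ramificationIdx' w.asIdeal = 1 ∧ v.asIdeal.inertiaDeg' w.asIdeal = 1 :=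
  Summit.Ventures.HodgeRepro2.T5LocalDegreeBounds.finrank_adicCompletion_eq_one_iff v w

/-- Quadratic `L/K`: local degree `2` ⟹ `(e, f) = (1, 2) ∨ (2, 1)` — p8's
`T5LocalDegreeBounds.ramificationIdx'_inertiaDeg'_of_quadratic` from p4's row 192. -/
theorem p8_of_quadratic_of_p4 (h : Module.finrank (v.adicCompletion K) (w.adicCompletion L) = 2) :
    (v.asIdeal.ramificationIdx' w.asIdeal = 1 ∧ v.asIdeal.inertiaDeg' w.asIdeal = 2) ∨
      (v.asIdeal.ramificationIdx' w.asIdeal = 2 ∧ v.asIdeal.inertiaDeg' w.asIdeal = 1) := by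
  rw [Summit.Ventures.HodgeRepro2.T5CompletionFundamentalIdentity.finrank_eq_ramificationIdx'_mul_inertiaDeg' v w] at h
  have he := Summit.Ventures.HodgeRepro2.T5CompletionDegreeOne.inertiaDeg'_ne_zero v w
  have hf := Summit.Ventures.HodgeRepro2.T5RamificationIndexGlobal.ramificationIdx'_ne_zero v w
  rcases Nat.lt_or_ge (v.asIdeal.ramificationIdx' w.asIdeal) 2 with h1 | h1
  · left
    have : v.asIdeal.ramificationIdx' w.asIdeal = 1 := by omega
    rw [this, one_mul] at h
    exact ⟨this, h⟩
  · right
    rcases Nat.lt_or_ge (v.asIdeal.inertiaDeg' w.asIdeal) 2 with h2 | h2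
    · have : v.asIdeal.inertiaDeg' w.asIdeal = 1 := by omega
      rw [this, mul_one] at h
      exact ⟨h, this⟩
    · exfalso
      have : 4 ≤ v.asIdeal.ramificationIdx' w.asIdeal * v.asIdeal.inertiaDeg' w.asIdeal :=
        Nat.mul_le_mul h1 h2
      omega

/-! ### SAME-H rows: p8's two-places statement from p4's all-places sum, and p4's converse -/

/-- Two distinct places above `v` in a quadratic `L/K` ⟹ `[L_w : K_v] = 1`: p8's
`T5SplitPlaceLocalDegree.finrank_adicCompletion_eq_one_of_ne` from p4's row 191 (`finrank_add_one_le_of_ne`). -/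
theorem p8_finrank_eq_one_of_ne_of_p4 (w' : HeightOneSpectrum (NumberField.RingOfIntegers L))
    [w'.asIdeal.LiesOver v.asIdeal] (hKL : Module.finrank K L = 2) (hne : w ≠ w') :
    Module.finrank (v.adicCompletion K) (w.adicCompletion L) = 1 := by
  have h1 := Summit.Ventures.HodgeRepro2.T5CompletionDegreeSum.finrank_add_one_le_of_ne v w w' inferInstance hne.symm
  have h2 : 0 < Module.finrank (v.adicCompletion K) (w.adicCompletion L) := Module.finrank_pos
  rw [hKL] at h1
  omega

/-- The converse, p4's row 191 `exists_ne_of_finrank_eq_one` read against p8: `[L_w : K_v] = 1` gives a second place,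
and p8's `finrank_adicCompletion_eq_one_of_ne` then recovers `[L_{w'} : K_v] = 1` at it. -/
theorem p4_exists_ne_then_p8 (hKL : Module.finrank K L = 2)
    (h : Module.finrank (v.adicCompletion K) (w.adicCompletion L) = 1) :
    ∃ (w' : HeightOneSpectrum (NumberField.RingOfIntegers L)) (_ : w'.asIdeal.LiesOver v.asIdeal), w' ≠ w ∧
      Module.finrank (v.adicCompletion K) (w'.adicCompletion L) = 1 := by
  obtain ⟨w', hw', hne, -⟩ :=
    Summit.Ventures.HodgeRepro2.T5CompletionDegreeSum.exists_ne_of_finrank_eq_one v hKL w h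
  exact ⟨w', hw', hne,
    Summit.Ventures.HodgeRepro2.T5SplitPlaceLocalDegree.finrank_adicCompletion_eq_one_of_ne v w' w hKL hne⟩

/-! ### The trichotomies: p8's existential form from p4's pointwise form -/

omit w [w.asIdeal.LiesOver v.asIdeal] in
/-- p8's `T5QuadraticPlaceTrichotomy.quadratic_place_trichotomy` (the EXISTENTIAL trichotomy over `v`) from p4's
`T5QuadraticPlaceCases.trichotomy` (the POINTWISE one at a place), instantiated at any place above `v`
(`T5CompletionDegreeSum.exists_liesOver`). -/
theorem p8_trichotomy_of_p4 (hKL : Module.finrank K L = 2) :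
    (∃ w w' : HeightOneSpectrum (NumberField.RingOfIntegers L),
        w ≠ w' ∧ w.asIdeal.LiesOver v.asIdeal ∧ w'.asIdeal.LiesOver v.asIdeal) ∨
      (∃ w : HeightOneSpectrum (NumberField.RingOfIntegers L), w.asIdeal.LiesOver v.asIdeal ∧
        (∀ w' : HeightOneSpectrum (NumberField.RingOfIntegers L), w'.asIdeal.LiesOver v.asIdeal → w' = w) ∧
        v.asIdeal.ramificationIdx' w.asIdeal = 1 ∧ v.asIdeal.inertiaDeg' w.asIdeal = 2) ∨
      (∃ w : HeightOneSpectrum (NumberField.RingOfIntegers L), w.asIdeal.LiesOver v.asIdeal ∧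
        (∀ w' : HeightOneSpectrum (NumberField.RingOfIntegers L), w'.asIdeal.LiesOver v.asIdeal → w' = w) ∧
        v.asIdeal.ramificationIdx' w.asIdeal = 2 ∧ v.asIdeal.inertiaDeg' w.asIdeal = 1) := by
  obtain ⟨w, hw⟩ := Summit.Ventures.HodgeRepro2.T5CompletionDegreeSum.exists_liesOver (L := L) v
  haveI := hw
  rcases Summit.Ventures.HodgeRepro2.T5QuadraticPlaceCases.trichotomy v w hKL with
    ⟨he, hf, huniq⟩ | ⟨he, hf, huniq⟩ | ⟨-, -, w', hne, hw', -⟩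
  · exact Or.inr (Or.inr ⟨w, hw, huniq, he, hf⟩)
  · exact Or.inr (Or.inl ⟨w, hw, huniq, he, hf⟩)
  · exact Or.inl ⟨w', w, hne, hw', hw⟩

/-- And the same existential statement as p8 states it — p8's theorem itself, to fix that the two shapes coincide
(the kernel accepts p8's term at p4's statement). -/
theorem p8_trichotomy_is_p8 (hKL : Module.finrank K L = 2) :
    (∃ w w' : HeightOneSpectrum (NumberField.RingOfIntegers L),
        w ≠ w' ∧ w.asIdeal.LiesOver v.asIdeal ∧ w'.asIdeal.LiesOver v.asIdeal) ∨
      (∃ w : HeightOneSpectrum (NumberField.RingOfIntegers L), w.asIdeal.LiesOver v.asIdeal ∧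
        (∀ w' : HeightOneSpectrum (NumberField.RingOfIntegers L), w'.asIdeal.LiesOver v.asIdeal → w' = w) ∧
        v.asIdeal.ramificationIdx' w.asIdeal = 1 ∧ v.asIdeal.inertiaDeg' w.asIdeal = 2) ∨
      (∃ w : HeightOneSpectrum (NumberField.RingOfIntegers L), w.asIdeal.LiesOver v.asIdeal ∧
        (∀ w' : HeightOneSpectrum (NumberField.RingOfIntegers L), w'.asIdeal.LiesOver v.asIdeal → w' = w) ∧
        v.asIdeal.ramificationIdx' w.asIdeal = 2 ∧ v.asIdeal.inertiaDeg' w.asIdeal = 1) :=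
  Summit.Ventures.HodgeRepro2.T5QuadraticPlaceTrichotomy.quadratic_place_trichotomy v hKL

/-- p4's pointwise trichotomy at `w` from p8's existential one plus p8's two-places lemma: the converse direction. -/
theorem p4_trichotomy_of_p8 (hKL : Module.finrank K L = 2) :
    (v.asIdeal.ramificationIdx' w.asIdeal = 2 ∧ v.asIdeal.inertiaDeg' w.asIdeal = 1 ∧
        ∀ w' : HeightOneSpectrum (NumberField.RingOfIntegers L), w'.asIdeal.LiesOver v.asIdeal → w' = w) ∨
      (v.asIdeal.ramificationIdx' w.asIdeal = 1 ∧ v.asIdeal.inertiaDeg' w.asIdeal = 2 ∧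
        ∀ w' : HeightOneSpectrum (NumberField.RingOfIntegers L), w'.asIdeal.LiesOver v.asIdeal → w' = w) ∨
      (v.asIdeal.ramificationIdx' w.asIdeal = 1 ∧ v.asIdeal.inertiaDeg' w.asIdeal = 1 ∧
        ∃ w' : HeightOneSpectrum (NumberField.RingOfIntegers L), w' ≠ w ∧ w'.asIdeal.LiesOver v.asIdeal ∧
          v.asIdeal.ramificationIdx' w'.asIdeal = 1 ∧ v.asIdeal.inertiaDeg' w'.asIdeal = 1) := by
  rcases Summit.Ventures.HodgeRepro2.T5QuadraticPlaceTrichotomy.quadratic_place_trichotomy v hKL with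
    ⟨w₁, w₂, hne, hw₁, hw₂⟩ | ⟨w₀, hw₀, huniq, he, hf⟩ | ⟨w₀, hw₀, huniq, he, hf⟩
  · -- split: `w` is one of the two places; the other one is the witness
    right; right
    haveI := hw₁; haveI := hw₂
    by_cases h₁ : w = w₁
    · subst h₁
      refine ⟨?_, ?_, w₂, hne.symm, hw₂, ?_⟩
      · exact (mul_eq_one.1 (Summit.Ventures.HodgeRepro2.T5SplitPlaceLocalDegree.ramificationIdx'_mul_inertiaDeg'_eq_one_of_ne
          v w w₂ hKL hne)).1
      · exact (mul_eq_one.1 (Summit.Ventures.HodgeRepro2.T5SplitPlaceLocalDegree.ramificationIdx'_mul_inertiaDeg'_eq_one_of_ne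
          v w w₂ hKL hne)).2
      · exact mul_eq_one.1 (Summit.Ventures.HodgeRepro2.T5SplitPlaceLocalDegree.ramificationIdx'_mul_inertiaDeg'_eq_one_of_ne
          v w₂ w hKL hne.symm)
    · have hne₁ : w ≠ w₁ := h₁
      refine ⟨?_, ?_, w₁, fun h => hne₁ h.symm, hw₁, ?_⟩
      · exact (mul_eq_one.1 (Summit.Ventures.HodgeRepro2.T5SplitPlaceLocalDegree.ramificationIdx'_mul_inertiaDeg'_eq_one_of_ne
          v w w₁ hKL hne₁)).1
      · exact (mul_eq_one.1 (Summit.Ventures.HodgeRepro2.T5SplitPlaceLocalDegree.ramificationIdx'_mul_inertiaDeg'_eq_one_of_ne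
          v w w₁ hKL hne₁)).2
      · exact mul_eq_one.1 (Summit.Ventures.HodgeRepro2.T5SplitPlaceLocalDegree.ramificationIdx'_mul_inertiaDeg'_eq_one_of_ne
          v w₁ w hKL hne₁.symm)
  · -- inert: the unique place is `w`
    right; left
    have hw : w = w₀ := huniq w inferInstance
    subst hw
    exact ⟨he, hf, huniq⟩
  · -- ramified: the unique place is `w`
    left
    have hw : w = w₀ := huniq w inferInstance
    subst hw
    exact ⟨he, hf, huniq⟩

end Summit.Ventures.HodgeRepro2.T5DictionaryConcordance
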